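import Literature.AnabelianGeometry.AbsoluteAnabelian.MLFGaloisUnitsEndomorphismsArePowers
import Literature.AnabelianGeometry.AbsoluteAnabelian.MLFGaloisModelPairs
import HarnessLib

/-!
# Equivariant group endomorphisms of `k̄^×` over `id_{G_k}`: injectivity, surjectivity, the fibre `{±1}`,
# and the `TM`/`TLG` bridge

Proof-only sequel (theorems only, no definitions) of `MLFGaloisUnitsEndomorphismsArePowers.lean` (abc-iut-L4-t2 gen 11:
an equivariant endomorphism of `k̄^×` over `id_{G_k}` is `x ↦ xᴹ`, `M ∈ ℤ`); S. Mochizuki, *Topics in Absolute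
Anabelian Geometry III*, Def. 3.1 (ii) p. 67 and Prop. 3.3 (ii) p. 74 ("if `T = TLG`, then the resulting map
`Isom((Π ↷ M),(Π* ↷ M*)) → Isom(Π, Π*)` is surjective, with fibers of cardinality two"; bib key
`MochizukiAbsTopIII2015`, lit key `paper:url-5493eb38cbb7`).  Consequences of the classification:

* `MLFClosure.nonZeroDivisors_monoidHom_eq_id_of_fix_rootsOfUnity`: an equivariant endomorphism fixing `μ_∞`
  is the identity (`N ∣ M − 1` for every `N`) — the `→*` form of abc-iut-L6-t13's
  `nonZeroDivisors_mulEquiv_eq_self_of_fix_rootsOfUnity` (bijectivity not needed);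
* `MLFClosure.nonZeroDivisors_monoidHom_injective_iff` / `…_bijective_iff`: injective ⟺ bijective ⟺
  `γ = id` or `γ = (·)⁻¹` (`M = ±1`; `M = 0` identifies `±1`, `|M| ≥ 2` kills `μ_{|M|}`) — the `→*` recovery of
  L6-t13's `nonZeroDivisors_mulEquiv_eq_self_or_eq_inv`: the "fibres of cardinality two" of Prop. 3.3 (ii) at the
  model `TLG`-pair are `End ∩ Aut = {x ↦ x^{±1}} = ℤˣ ⊂ ℤ = End`;
* `MLFClosure.nonZeroDivisors_monoidHom_surjective_iff`: surjective ⟺ `γ ≠ 1` (`M ≠ 0`; `k̄` alg. closed);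
* `MLFClosure.zpow_mapsTo_nonzeroIntegers_iff`, `MLFClosure.nonZeroDivisors_monoidHom_mapsTo_nonzeroIntegers_iff`
  (the `TM`/`TLG` bridge): `x ↦ xᴹ` preserves `𝒪_k̄^⊳ ⊆ k̄^×` iff `0 ≤ M`, so the endomorphisms of the `TLG`-pair
  that restrict to the `TM`-pair `(G_k ↷ 𝒪_k̄^⊳)` are exactly the `ℕ`-power maps of
  `MonoidKummerEndomorphismsArePowers` (`MLFClosure.nonzeroIntegers_monoidHom_eq_pow`), and the inversion is the
  one automorphism of the `TLG`-pair over `id` that is not the groupification of a `TM`-morphism (cf.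
  abc-iut-w4-d009's `tlgIso_isoM_eq_tlgIso_or_mul_eq_one`).

HONEST FRAMING: OUR kernel check of classical facts about a `p`-adic field and its algebraic closure, about the
cell's typed model of the category of [AbsTopIII] Def. 3.1; count-neutral for the node Prop. 3.3 (ii); nothing here
bears on [IUTchIII] Cor. 3.12; no side is taken; nothing asserts that abc is proved or refuted.
-/

noncomputable section

open scoped Classical

namespace Literature.AnabelianGeometry.AbsoluteAnabelian

open _root_.ValuativeRel IntermediateField
open Literature.NumberTheory.GaloisRepresentations

universe u

namespace MLFClosure

variable {C : MLFClosure.{u}}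

/-- The normalised additive valuation of a non-archimedean local field, packaged as data: `ord : k → ℤ`,
additive on non-zero elements, `≤ 0` on `𝒪_k ∖ 0`, `= -1` at a uniformiser `ϖ ∈ 𝒪_k` (copy of the private
lemma of `MonoidKummerEndomorphismsArePowers.lean`). Ref: Serre, *Local Fields*, Ch. II §1. [folklore] -/
private theorem exists_ord' (k : Type u) [Field k] [ValuativeRel k] [TopologicalSpace k]
    [IsNonarchimedeanLocalField k] :
    ∃ (ord : k → ℤ) (ϖ : k), ϖ ≠ 0 ∧ ϖ ∈ 𝒪[k] ∧ ord ϖ = -1 ∧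
      (∀ a b : k, a ≠ 0 → b ≠ 0 → ord (a * b) = ord a + ord b) ∧
      (∀ (a : k) (n : ℕ), a ≠ 0 → ord (a ^ n) = n * ord a) ∧
      (∀ a : k, a ≠ 0 → a ∈ 𝒪[k] → ord a ≤ 0) := by
  set e := _root_.IsNonarchimedeanLocalField.valueGroupWithZeroIsoInt k with he
  refine ⟨fun a => WithZero.log (e (valuation k a)), ?_⟩
  obtain ⟨ϖ, hϖ⟩ := exists_units_isUniformizer (F := k)
  have hne : ∀ a : k, a ≠ 0 → e (valuation k a) ≠ 0 := fun a ha h =>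
    ((Valuation.ne_zero_iff _).mpr ha) (e.injective (h.trans (map_zero e).symm))
  refine ⟨(ϖ : k), ϖ.ne_zero, le_of_lt hϖ.val_lt_one, ?_, ?_, ?_, ?_⟩
  · show WithZero.log (e (valuation k (ϖ : k))) = -1
    rw [hϖ.val, IsNonarchimedeanLocalField.valueGroupWithZeroIsoInt_generator, WithZero.log_exp]
  · intro a b ha hb
    show WithZero.log (e (valuation k (a * b))) = WithZero.log (e (valuation k a)) +
      WithZero.log (e (valuation k b))
    rw [map_mul, map_mul, WithZero.log_mul (hne a ha) (hne b hb)]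
  · intro a n ha
    show WithZero.log (e (valuation k (a ^ n))) = n * WithZero.log (e (valuation k a))
    rw [map_pow, map_pow, WithZero.log_pow, nsmul_eq_mul]
  · intro a ha hint
    show WithZero.log (e (valuation k a)) ≤ 0
    rw [WithZero.log_le_iff_le_exp (hne a ha), WithZero.exp_zero, ← map_one e, map_le_map_iff]
    exact hint

/-- `2 ∈ k̄^×` (characteristic `0`). [folklore] -/
private theorem two_mem_nonZeroDivisors' : (2 : C.K) ∈ nonZeroDivisors C.K :=
  mem_nonZeroDivisors_of_ne_zero (by
    haveI : CharZero C.K := charZero_of_injective_algebraMap (algebraMap C.k C.K).injective; exact two_ne_zero)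

/-- **An equivariant group endomorphism of `k̄^×` over `id_{G_k}` that fixes the roots of unity is the
identity** (`ζᴹ = ζ` for a primitive `N`-th root of unity gives `N ∣ M − 1` for every `N`, so `M = 1`): the
`→*` form of L6-t13's `nonZeroDivisors_mulEquiv_eq_self_of_fix_rootsOfUnity` — bijectivity is not needed.
[cite: MochizukiAbsTopIII2015, Proposition 3.3 (ii) p.74] -/
theorem nonZeroDivisors_monoidHom_eq_id_of_fix_rootsOfUnity
    (γ : ↥(nonZeroDivisors C.K) →* ↥(nonZeroDivisors C.K))
    (hγ : ∀ (σ : C.K ≃ₐ[C.k] C.K) (x : ↥(nonZeroDivisors C.K)),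
      (γ ⟨σ • (x : C.K), smul_mem_nonZeroDivisors σ x.2⟩ : C.K) = σ • (γ x : C.K))
    (hfix : ∀ (u : ↥(nonZeroDivisors C.K)) (n : ℕ), 0 < n → (u : C.K) ^ n = 1 → γ u = u) :
    γ = MonoidHom.id _ := by
  haveI : IsAlgClosed C.K := IsAlgClosure.isAlgClosed C.k
  haveI : CharZero C.K := charZero_of_injective_algebraMap (algebraMap C.k C.K).injective
  obtain ⟨M, hM⟩ := nonZeroDivisors_monoidHom_eq_zpow γ hγ
  suffices hM1 : M = 1 by
    subst hM1
    exact MonoidHom.ext fun x => Subtype.ext (by rw [hM, zpow_one, MonoidHom.id_apply])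
  -- `N ∣ M - 1` for every `N ≥ 1`
  have key : ∀ N : ℕ, 0 < N → (N : ℤ) ∣ M - 1 := by
    intro N hN
    haveI : NeZero N := ⟨hN.ne'⟩
    obtain ⟨ζ, hζ⟩ := HasEnoughRootsOfUnity.exists_primitiveRoot C.K N
    have hζmem : ζ ∈ nonZeroDivisors C.K :=
      C.mem_nonZeroDivisors_of_pow_eq hN (Submonoid.one_mem _) hζ.pow_eq_one
    have h := congrArg Subtype.val (hfix ⟨ζ, hζmem⟩ N hN hζ.pow_eq_one)
    rw [hM] at h
    have hζ0 : ζ ≠ 0 := nonZeroDivisors.ne_zero hζmem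
    have h1 : ζ ^ (M - 1) = 1 := by
      rw [zpow_sub_one₀ hζ0, h, mul_inv_cancel₀ hζ0]
    exact (hζ.zpow_eq_one_iff_dvd (M - 1)).mp h1
  have hdvd := key ((M - 1).natAbs + 1) (Nat.succ_pos _)
  have h0 : M - 1 = 0 := Int.eq_zero_of_dvd_of_natAbs_lt_natAbs hdvd
    (by rw [Int.natAbs_natCast]; exact Nat.lt_succ_self _)
  omega

/-- `-1 ≠ 1` in `k̄` (characteristic `0`). [folklore] -/
private theorem neg_one_ne_one_K : (-1 : C.K) ≠ 1 := by
  haveI : CharZero C.K := charZero_of_injective_algebraMap (algebraMap C.k C.K).injective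
  intro h
  exact two_ne_zero (by linear_combination -h : (2 : C.K) = 0)

/-- **An equivariant group endomorphism of `k̄^×` over `id_{G_k}` is INJECTIVE iff it is the identity or the
inversion** (`x ↦ xᴹ` is injective on `k̄^×` only for `M = ±1`: `M = 0` identifies `-1` and `1`, `|M| ≥ 2` kills
a primitive `|M|`-th root of unity). [cite: MochizukiAbsTopIII2015, Proposition 3.3 (ii) p.74] -/
theorem nonZeroDivisors_monoidHom_injective_iff
    (γ : ↥(nonZeroDivisors C.K) →* ↥(nonZeroDivisors C.K))
    (hγ : ∀ (σ : C.K ≃ₐ[C.k] C.K) (x : ↥(nonZeroDivisors C.K)),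
      (γ ⟨σ • (x : C.K), smul_mem_nonZeroDivisors σ x.2⟩ : C.K) = σ • (γ x : C.K)) :
    Function.Injective γ ↔
      ((∀ x, γ x = x) ∨ (∀ x : ↥(nonZeroDivisors C.K), (γ x : C.K) = (x : C.K)⁻¹)) := by
  haveI : IsAlgClosed C.K := IsAlgClosure.isAlgClosed C.k
  haveI : CharZero C.K := charZero_of_injective_algebraMap (algebraMap C.k C.K).injective
  obtain ⟨M, hM⟩ := nonZeroDivisors_monoidHom_eq_zpow γ hγ
  refine ⟨fun hinj => ?_, fun h => ?_⟩
  · rcases Nat.lt_or_ge M.natAbs 2 with hlt | hge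
    · -- `|M| ≤ 1`
      rcases Int.natAbs_eq M with hpos | hneg
      · interval_cases h : M.natAbs
        · -- `M = 0`: `γ` is constant
          exfalso
          have hM0 : M = 0 := by omega
          have h1 : γ ⟨-1, mem_nonZeroDivisors_of_ne_zero (neg_ne_zero.mpr one_ne_zero)⟩ = γ 1 :=
            Subtype.ext (by rw [hM, hM, hM0, zpow_zero, zpow_zero])
          exact neg_one_ne_one_K (C := C) (by simpa using congrArg Subtype.val (hinj h1))
        · left
          intro x
          exact Subtype.ext (by rw [hM, hpos]; simp)
      · interval_cases h : M.natAbs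
        · exfalso
          have hM0 : M = 0 := by omega
          have h1 : γ ⟨-1, mem_nonZeroDivisors_of_ne_zero (neg_ne_zero.mpr one_ne_zero)⟩ = γ 1 :=
            Subtype.ext (by rw [hM, hM, hM0, zpow_zero, zpow_zero])
          exact neg_one_ne_one_K (C := C) (by simpa using congrArg Subtype.val (hinj h1))
        · right
          intro x
          rw [hM, hneg]
          simp
    · -- `|M| ≥ 2`: a primitive `|M|`-th root of unity `ζ ≠ 1` has `ζᴹ = 1 = 1ᴹ`
      exfalso
      haveI : NeZero M.natAbs := ⟨by omega⟩
      obtain ⟨ζ, hζ⟩ := HasEnoughRootsOfUnity.exists_primitiveRoot C.K M.natAbs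
      have hζmem : ζ ∈ nonZeroDivisors C.K :=
        C.mem_nonZeroDivisors_of_pow_eq (by omega) (Submonoid.one_mem _) hζ.pow_eq_one
      have hζM : ζ ^ M = 1 := by
        rcases Int.natAbs_eq M with hpos | hneg
        · rw [hpos, zpow_natCast, hζ.pow_eq_one]
        · rw [hneg, zpow_neg, zpow_natCast, hζ.pow_eq_one, inv_one]
      have h1 : γ ⟨ζ, hζmem⟩ = γ 1 :=
        Subtype.ext (by rw [hM, hM, hζM, OneMemClass.coe_one, one_zpow])
      exact hζ.ne_one hge (by simpa using congrArg Subtype.val (hinj h1))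
  · rcases h with h | h
    · intro a b hab
      rwa [h, h] at hab
    · intro a b hab
      have := congrArg Subtype.val hab
      rw [h, h, inv_inj] at this
      exact Subtype.ext this

/-- **… is BIJECTIVE iff it is the identity or the inversion** — the `→*` recovery of abc-iut-L6-t13's
`nonZeroDivisors_mulEquiv_eq_self_or_eq_inv`: the "fibres of cardinality two" of [AbsTopIII] Prop. 3.3 (ii)
at the model `TLG`-pair are `End ∩ Aut = {x ↦ x^{±1}} = ℤˣ`. [cite: MochizukiAbsTopIII2015, Proposition 3.3 (ii) p.74] -/
theorem nonZeroDivisors_monoidHom_bijective_iff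
    (γ : ↥(nonZeroDivisors C.K) →* ↥(nonZeroDivisors C.K))
    (hγ : ∀ (σ : C.K ≃ₐ[C.k] C.K) (x : ↥(nonZeroDivisors C.K)),
      (γ ⟨σ • (x : C.K), smul_mem_nonZeroDivisors σ x.2⟩ : C.K) = σ • (γ x : C.K)) :
    Function.Bijective γ ↔
      ((∀ x, γ x = x) ∨ (∀ x : ↥(nonZeroDivisors C.K), (γ x : C.K) = (x : C.K)⁻¹)) := by
  refine ⟨fun hbij => (nonZeroDivisors_monoidHom_injective_iff γ hγ).mp hbij.1, fun h => ?_⟩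
  refine ⟨(nonZeroDivisors_monoidHom_injective_iff γ hγ).mpr h, fun y => ?_⟩
  rcases h with h | h
  · exact ⟨y, h y⟩
  · refine ⟨⟨(y : C.K)⁻¹, mem_nonZeroDivisors_of_ne_zero
      (inv_ne_zero (nonZeroDivisors.coe_ne_zero y))⟩, Subtype.ext ?_⟩
    rw [h, inv_inv]

/-- **… is SURJECTIVE iff it is not the trivial homomorphism** (`x ↦ xᴹ` is onto `k̄^×` for every `M ≠ 0`,
`k̄` being algebraically closed; `M = 0` is the constant map `1`).  So `End_{id}((G_k ↷ k̄^×)) ∖ {1}` consists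
of surjections, of which exactly two (`M = ±1`) are isomorphisms.
[cite: MochizukiAbsTopIII2015, Proposition 3.3 (ii) p.74] -/
theorem nonZeroDivisors_monoidHom_surjective_iff
    (γ : ↥(nonZeroDivisors C.K) →* ↥(nonZeroDivisors C.K))
    (hγ : ∀ (σ : C.K ≃ₐ[C.k] C.K) (x : ↥(nonZeroDivisors C.K)),
      (γ ⟨σ • (x : C.K), smul_mem_nonZeroDivisors σ x.2⟩ : C.K) = σ • (γ x : C.K)) :
    Function.Surjective γ ↔ γ ≠ 1 := by
  haveI : IsAlgClosed C.K := IsAlgClosure.isAlgClosed C.k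
  haveI : CharZero C.K := charZero_of_injective_algebraMap (algebraMap C.k C.K).injective
  obtain ⟨M, hM⟩ := nonZeroDivisors_monoidHom_eq_zpow γ hγ
  refine ⟨fun hsurj h1 => ?_, fun hne y => ?_⟩
  · obtain ⟨x, hx⟩ := hsurj ⟨2, two_mem_nonZeroDivisors'⟩
    rw [h1, MonoidHom.one_apply] at hx
    have h2 : (1 : C.K) = 2 := by simpa using congrArg Subtype.val hx
    norm_num at h2
  · have hM0 : M ≠ 0 := by
      rintro rfl
      exact hne (MonoidHom.ext fun x => Subtype.ext (by rw [hM, zpow_zero, MonoidHom.one_apply,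
        OneMemClass.coe_one]))
    have hn : 0 < M.natAbs := Int.natAbs_pos.mpr hM0
    have hy0 : (y : C.K) ≠ 0 := nonZeroDivisors.coe_ne_zero y
    obtain ⟨z, hz⟩ := IsAlgClosed.exists_pow_nat_eq (y : C.K) hn
    have hzmem : z ∈ nonZeroDivisors C.K := C.mem_nonZeroDivisors_of_pow_eq hn y.2 hz
    have hz0 : z ≠ 0 := nonZeroDivisors.ne_zero hzmem
    rcases Int.natAbs_eq M with hpos | hneg
    · exact ⟨⟨z, hzmem⟩, Subtype.ext (by rw [hM, hpos, zpow_natCast]; exact hz)⟩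
    · refine ⟨⟨z⁻¹, mem_nonZeroDivisors_of_ne_zero (inv_ne_zero hz0)⟩, Subtype.ext ?_⟩
      rw [hM, hneg, zpow_neg, zpow_natCast, inv_pow, inv_inv]
      exact hz

/-- **`x ↦ xᴹ` maps the submonoid `𝒪_k̄^⊳ ⊆ k̄^×` into itself iff `0 ≤ M`** (a uniformiser `ϖ` of `k` has
`ϖᴹ ∉ 𝒪_k` for `M < 0`).  So the equivariant endomorphisms of the `TLG`-pair `(G_k ↷ k̄^×)` that restrict to the
`TM`-pair `(G_k ↷ 𝒪_k̄^⊳)` are exactly gen 10's `ℕ ⊂ ℤ` (`MLFClosure.nonzeroIntegers_monoidHom_eq_pow`), and the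
inversion `M = -1` is the one AUTOmorphism of the `TLG`-pair over `id` that is not the groupification of a
`TM`-morphism. [cite: MochizukiAbsTopIII2015, Definition 3.1 (ii) p.67] -/
theorem zpow_mapsTo_nonzeroIntegers_iff (M : ℤ) :
    (∀ x : C.K, x ∈ nonzeroIntegers C.k C.K → x ^ M ∈ nonzeroIntegers C.k C.K) ↔ 0 ≤ M := by
  refine ⟨fun h => ?_, fun hM x hx => ?_⟩
  · obtain ⟨ord, ϖ, hϖ0, hϖint, hordϖ, hmul, hpow, hint⟩ := exists_ord' C.k
    have hinj := (algebraMap C.k C.K).injective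
    have hord1 : ord 1 = 0 := by
      have := hmul 1 1 one_ne_zero one_ne_zero
      rw [mul_one] at this
      linarith
    have hordinv : ∀ a : C.k, a ≠ 0 → ord a⁻¹ = - ord a := by
      intro a ha
      have := hmul a a⁻¹ ha (inv_ne_zero ha)
      rw [mul_inv_cancel₀ ha, hord1] at this
      linarith
    have hϖKM : algebraMap C.k C.K ϖ ∈ nonzeroIntegers C.k C.K :=
      ⟨(isIntegral_algebraMap_iff_mem_integer C.k C.K).mpr hϖint, (map_ne_zero_iff _ hinj).mpr hϖ0⟩
    have hmem := h _ hϖKM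
    rw [← map_zpow₀] at hmem
    have hϖMint : ϖ ^ M ∈ 𝒪[C.k] := (isIntegral_algebraMap_iff_mem_integer C.k C.K).mp hmem.1
    by_contra hneg
    have hle := hint (ϖ ^ M) (zpow_ne_zero _ hϖ0) hϖMint
    have hM' : M = -(((-M).toNat : ℕ) : ℤ) := by rw [Int.toNat_of_nonneg (by omega)]; ring
    rw [hM', zpow_neg, zpow_natCast, hordinv _ (pow_ne_zero _ hϖ0), hpow _ _ hϖ0, hordϖ] at hle
    have : 0 < (-M).toNat := by omega
    linarith
  · have hM' : M = ((M.toNat : ℕ) : ℤ) := (Int.toNat_of_nonneg hM).symm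
    rw [hM', zpow_natCast]
    exact pow_mem hx _

/-- **An equivariant group endomorphism of `k̄^×` over `id_{G_k}` restricts to `𝒪_k̄^⊳` iff it is `x ↦ xᴹ` with
`M ∈ ℕ`** — i.e. iff it is (the groupification of) one of the `TM`-endomorphisms classified by
`MLFClosure.nonzeroIntegers_monoidHom_eq_pow`. [cite: MochizukiAbsTopIII2015, Definition 3.1 (ii) p.67] -/
theorem nonZeroDivisors_monoidHom_mapsTo_nonzeroIntegers_iff
    (γ : ↥(nonZeroDivisors C.K) →* ↥(nonZeroDivisors C.K))
    (hγ : ∀ (σ : C.K ≃ₐ[C.k] C.K) (x : ↥(nonZeroDivisors C.K)),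
      (γ ⟨σ • (x : C.K), smul_mem_nonZeroDivisors σ x.2⟩ : C.K) = σ • (γ x : C.K)) :
    (∀ x : ↥(nonZeroDivisors C.K), (x : C.K) ∈ nonzeroIntegers C.k C.K →
        (γ x : C.K) ∈ nonzeroIntegers C.k C.K) ↔
      ∃ N : ℕ, ∀ x : ↥(nonZeroDivisors C.K), (γ x : C.K) = (x : C.K) ^ N := by
  obtain ⟨M, hM⟩ := nonZeroDivisors_monoidHom_eq_zpow γ hγ
  refine ⟨fun h => ?_, fun ⟨N, hN⟩ x hx => by rw [hN]; exact pow_mem hx _⟩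
  have hM0 : 0 ≤ M := (zpow_mapsTo_nonzeroIntegers_iff (C := C) M).mp fun x hx => by
    have := h ⟨x, mem_nonZeroDivisors_of_ne_zero hx.2⟩ hx
    rwa [hM] at this
  refine ⟨M.toNat, fun x => ?_⟩
  rw [hM, ← zpow_natCast, Int.toNat_of_nonneg hM0]

end MLFClosure

/-! ## Endomorphisms of the model `TLG`-pair over the identity of `G_k` -/

namespace GaloisMonoidPair.Hom

variable {C : MLFClosure.{u}} {D : ModelMLFGaloisData C.k C.K} (φ : GaloisMonoidPair.Hom D.tlgPair D.tlgPair)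
  (hφ : ∀ g : D.Pi, D.aug (φ.homPi g) = D.aug g)

include hφ in
/-- For an endomorphism `φ = (φ_Π, φ_M)` of the model `TLG`-pair `(Π_k ↷ k̄^×)` in `𝒞^MLF_TLG` COVERING THE IDENTITY
of `G_k` (`ε ∘ φ_Π = ε`), `φ_M` is `G_k`-EQUIVARIANT in the shape of `MLFClosure.nonZeroDivisors_monoidHom_eq_zpow`:
`φ_M(σ • x) = σ • φ_M(x)`. [cite: MochizukiAbsTopIII2015, Definition 3.1 (ii) p.67] -/
theorem tlg_homM_smul_of_overId (σ : C.K ≃ₐ[C.k] C.K) (x : ↥(nonZeroDivisors C.K)) :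
    (φ.homM ⟨σ • (x : C.K), smul_mem_nonZeroDivisors σ x.2⟩ : C.K) = σ • (φ.homM x : C.K) := by
  obtain ⟨g, rfl⟩ := D.aug_surjective σ
  have hc : ∀ (g : D.Pi) (m : ↥(nonZeroDivisors C.K)),
      ((g • m : ↥(nonZeroDivisors C.K)) : C.K) = D.aug g • (m : C.K) := fun _ _ => rfl
  have h := congrArg Subtype.val (φ.smul_comm g x)
  rw [hc, hφ] at h
  exact h

include hφ in
/-- **Over `id_{G_k}`, the monoid component `φ_M` of an endomorphism of the model `TLG`-pair is a power map
`x ↦ xᴹ`, `M ∈ ℤ`.** [cite: MochizukiAbsTopIII2015, Proposition 3.3 (ii) p.74] -/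
theorem tlg_exists_homM_eq_zpow :
    ∃ M : ℤ, ∀ x : ↥(nonZeroDivisors C.K), (φ.homM x : C.K) = (x : C.K) ^ M :=
  MLFClosure.nonZeroDivisors_monoidHom_eq_zpow φ.homM (tlg_homM_smul_of_overId φ hφ)

include hφ in
/-- **Over `id_{G_k}`, an endomorphism of the model `TLG`-pair is a `T`-isomorphism (Def. 3.1 (ii): `φ_M`
bijective) iff `φ_M` is the identity or the inversion of `k̄^×`** — the printed "fibres of cardinality two" of
Prop. 3.3 (ii) over the identity, now among ALL endomorphisms of `𝒞^MLF_TLG` covering `id_{G_k}` (not only among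
isomorphisms of pairs). [cite: MochizukiAbsTopIII2015, Proposition 3.3 (ii) p.74] -/
theorem tlg_isTIso_iff_of_overId :
    φ.IsTIso ↔ ((∀ x, φ.homM x = x) ∨ (∀ x : ↥(nonZeroDivisors C.K), (φ.homM x : C.K) = (x : C.K)⁻¹)) :=
  MLFClosure.nonZeroDivisors_monoidHom_bijective_iff φ.homM (tlg_homM_smul_of_overId φ hφ)

include hφ in
/-- Over `id_{G_k}`: `φ_M` is surjective iff `φ_M ≠ 1` (every non-trivial endomorphism of the model `TLG`-pair
covering the identity is onto on `k̄^×`). [cite: MochizukiAbsTopIII2015, Proposition 3.3 (ii) p.74] -/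
theorem tlg_homM_surjective_iff_of_overId : Function.Surjective φ.homM ↔ φ.homM ≠ 1 :=
  MLFClosure.nonZeroDivisors_monoidHom_surjective_iff φ.homM (tlg_homM_smul_of_overId φ hφ)

include hφ in
/-- Over `id_{G_k}`: `φ_M` maps `𝒪_k̄^⊳` into itself iff `φ_M = (x ↦ xᴺ)` with `N ∈ ℕ` — i.e. iff `φ_M` is the
groupification of one of the `TM`-endomorphisms of `MonoidKummerEndomorphismsArePowers`.
[cite: MochizukiAbsTopIII2015, Definition 3.1 (ii) p.67] -/
theorem tlg_homM_mapsTo_nonzeroIntegers_iff_of_overId :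
    (∀ x : ↥(nonZeroDivisors C.K), (x : C.K) ∈ nonzeroIntegers C.k C.K →
        (φ.homM x : C.K) ∈ nonzeroIntegers C.k C.K) ↔
      ∃ N : ℕ, ∀ x : ↥(nonZeroDivisors C.K), (φ.homM x : C.K) = (x : C.K) ^ N :=
  MLFClosure.nonZeroDivisors_monoidHom_mapsTo_nonzeroIntegers_iff φ.homM (tlg_homM_smul_of_overId φ hφ)

end GaloisMonoidPair.Hom

end Literature.AnabelianGeometry.AbsoluteAnabelian

end
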